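import Summits.QuantumFields.QCD.Theses.HeatSlicedQuarks

/-!
# Stub `stub_sliceResummation` of line `Sketch`
(crux `Summit.QuantumFields.QCD.Theses.HeatSlicedQuarks.InterleavedHeatSliceFlow`, item stmt-QuantumFields-8891,
reshape r7 wave 2: proper-time resummation of the heat-slice covariance)

**Proper-time resummation** (generic linear algebra).  For a complex square matrix `A` over a finite index type
put `H = Aᴴ A` and `K_t = e^{-tH}`.  The line slices the propagator in proper time with covariances
`C_{a,b} = ∫_a^b K_t Aᴴ dt`; this stub is the bookkeeping identity that the slices telescope back to the
propagator: for every real `T` and entries `ξ, ζ`,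

  `Σ_η (∫_0^T (K_t Aᴴ)(ξ,η) dt) · A(η,ζ) = (1 - K_T)(ξ,ζ)`,

i.e. `(∫_0^T e^{-tH} Aᴴ dt) · A = 1 - e^{-TH}` entrywise, with the matrix product written as the explicit finite
sum over `η`.

Proof.  Move the constant right factors and the finite sum inside the (oriented) interval integral
(`intervalIntegral.integral_mul_const`, `intervalIntegral.integral_finsetSum`; integrability of each summand by
continuity of `t ↦ K_t Aᴴ`, from `NormedSpace.exp_continuous` in the `L^∞` operator normed algebra structure
`Matrix.Norms.Operator`, whose topology is the product one), and recognise the integrand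
`Σ_η (K_t Aᴴ)(ξ,η) A(η,ζ) = (K_t Aᴴ A)(ξ,ζ) = (K_t H)(ξ,ζ)` (`Matrix.mul_apply`, `Matrix.mul_assoc`).  After
identifying the complex scalar multiple `-(t : ℂ) • H` with the real one `t • (-H)`, the map `t ↦ -K_t` has
derivative `K_t H` along the real ray (`hasDerivAt_exp_smul_const`), so the fundamental theorem of calculus for
the entry `t ↦ -K_t(ξ,ζ)` (`hasDerivAt_pi`, `intervalIntegral.integral_eq_sub_of_hasDerivAt`) gives
`∫_0^T (K_t H)(ξ,ζ) dt = -K_T(ξ,ζ) + K_0(ξ,ζ) = (1 - K_T)(ξ,ζ)` (`NormedSpace.exp_zero`).  No hypothesis on the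
sign of `T`; Mathlib only.
-/

noncomputable section

namespace Summit.QuantumFields.QCD.Cruxes.InterleavedHeatSliceFlow.Sketch

open MeasureTheory intervalIntegral
open scoped Matrix

/-- The complex scalar multiple `-(t : ℂ) • H` of a complex matrix by a real `t` is the real scalar multiple
`t • (-H)` (so that the derivative of the exponential along a real ray applies). -/
private theorem sliceResummation_exp_smul {ι : Type*} [Fintype ι] [DecidableEq ι]
    (H : Matrix ι ι ℂ) (t : ℝ) :
    NormedSpace.exp (-(t : ℂ) • H) = NormedSpace.exp (t • (-H)) := by
  congr 1
  ext i j
  simp [Matrix.smul_apply, Complex.real_smul]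

/-- The map `t ↦ -e^{t • (-H)}` has derivative `e^{t • (-H)} H` along the real ray (derivative of the matrix
exponential, taken in the `L^∞` operator normed algebra structure `Matrix.Norms.Operator`; the exponential and
the topology do not depend on the chosen norm). -/
private theorem sliceResummation_hasDerivAt {ι : Type*} [Fintype ι] [DecidableEq ι]
    (H : Matrix ι ι ℂ) (t : ℝ) :
    HasDerivAt (fun t : ℝ => -NormedSpace.exp (t • (-H))) (NormedSpace.exp (t • (-H)) * H) t := by
  open scoped Matrix.Norms.Operator in
  have h := (hasDerivAt_exp_smul_const (𝕂 := ℝ) (-H) t).neg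
  rw [Matrix.mul_neg, neg_neg] at h
  exact h

/-- Continuity of `t ↦ e^{t • (-H)} H` (product topology on matrices). -/
private theorem sliceResummation_continuous_deriv {ι : Type*} [Fintype ι] [DecidableEq ι]
    (H : Matrix ι ι ℂ) :
    Continuous fun t : ℝ => NormedSpace.exp (t • (-H)) * H := by
  open scoped Matrix.Norms.Operator in
  exact (NormedSpace.exp_continuous.comp (continuous_id.smul continuous_const)).mul continuous_const

/-- Continuity of an entry of the smoothed adjoint `t ↦ (e^{-tAᴴA} Aᴴ)(ξ,η)`. -/
private theorem sliceResummation_continuous_entry {ι : Type*} [Fintype ι] [DecidableEq ι]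
    (A : Matrix ι ι ℂ) (ξ η : ι) :
    Continuous fun t : ℝ => (NormedSpace.exp (-(t : ℂ) • (Aᴴ * A)) * Aᴴ) ξ η := by
  open scoped Matrix.Norms.Operator in
  exact ((NormedSpace.exp_continuous.comp
    (Complex.continuous_ofReal.neg.smul continuous_const)).mul continuous_const).matrix_elem ξ η

/-- Fundamental theorem of calculus for the entry `t ↦ -e^{t • (-H)}(ξ,ζ)` between `0` and `T`:
`∫_0^T (e^{t • (-H)} H)(ξ,ζ) dt = (1 - e^{T • (-H)})(ξ,ζ)` (no hypothesis on the sign of `T`). -/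
private theorem sliceResummation_ftc {ι : Type*} [Fintype ι] [DecidableEq ι]
    (H : Matrix ι ι ℂ) (T : ℝ) (ξ ζ : ι) :
    ∫ t in (0 : ℝ)..T, (NormedSpace.exp (t • (-H)) * H) ξ ζ =
      ((1 : Matrix ι ι ℂ) - NormedSpace.exp (T • (-H))) ξ ζ := by
  have hderiv : ∀ t : ℝ, HasDerivAt (fun t : ℝ => (-NormedSpace.exp (t • (-H))) ξ ζ)
      ((NormedSpace.exp (t • (-H)) * H) ξ ζ) t :=
    fun t => hasDerivAt_pi.1 (hasDerivAt_pi.1 (sliceResummation_hasDerivAt H t) ξ) ζ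
  have hint : IntervalIntegrable (fun t : ℝ => (NormedSpace.exp (t • (-H)) * H) ξ ζ) volume 0 T :=
    ((sliceResummation_continuous_deriv H).matrix_elem ξ ζ).intervalIntegrable 0 T
  rw [intervalIntegral.integral_eq_sub_of_hasDerivAt (fun t _ => hderiv t) hint]
  simp only [zero_smul, NormedSpace.exp_zero, Matrix.neg_apply, Matrix.sub_apply, neg_sub_neg]

/-- **Proper-time resummation of the heat-slice covariance** (registered stub `stub_sliceResummation` of line
`Sketch`, reshape r7 wave 2; generic linear algebra): for every complex square matrix `A` over a finite index
type, every real `T` and entries `ξ, ζ`,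

  `Σ_η (∫_0^T (e^{-tAᴴA} Aᴴ)(ξ,η) dt) · A(η,ζ) = (1 - e^{-TAᴴA})(ξ,ζ)`,

i.e. the proper-time slices of the propagator telescope back: `(∫_0^T e^{-tH} Aᴴ dt) A = 1 - e^{-TH}` with
`H = Aᴴ A`.  Interchange of the finite sum and constant factors with the interval integral (integrability by
continuity), `Σ_η (K_t Aᴴ)(ξ,η) A(η,ζ) = (K_t H)(ξ,ζ)`, and the fundamental theorem of calculus for
`t ↦ -e^{-tH}(ξ,ζ)`, whose derivative is `(e^{-tH} H)(ξ,ζ)`. -/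
theorem stub_sliceResummation :
    ∀ (ι : Type) [Fintype ι] [DecidableEq ι] (A : Matrix ι ι ℂ) (T : ℝ) (ξ ζ : ι),
      ∑ η, (∫ t in (0 : ℝ)..T, (NormedSpace.exp (-(t : ℂ) • (Aᴴ * A)) * Aᴴ) ξ η) * A η ζ =
        ((1 : Matrix ι ι ℂ) - NormedSpace.exp (-(T : ℂ) • (Aᴴ * A))) ξ ζ := by
  intro ι _ _ A T ξ ζ
  -- integrability of each summand (continuity)
  have hint : ∀ η : ι, IntervalIntegrable
      (fun t : ℝ => (NormedSpace.exp (-(t : ℂ) • (Aᴴ * A)) * Aᴴ) ξ η * A η ζ) volume 0 T := fun η =>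
    ((sliceResummation_continuous_entry A ξ η).mul continuous_const).intervalIntegrable 0 T
  calc ∑ η, (∫ t in (0 : ℝ)..T, (NormedSpace.exp (-(t : ℂ) • (Aᴴ * A)) * Aᴴ) ξ η) * A η ζ
      = ∑ η, ∫ t in (0 : ℝ)..T, (NormedSpace.exp (-(t : ℂ) • (Aᴴ * A)) * Aᴴ) ξ η * A η ζ :=
        Finset.sum_congr rfl fun η _ => (intervalIntegral.integral_mul_const _ _).symm
    _ = ∫ t in (0 : ℝ)..T, ∑ η, (NormedSpace.exp (-(t : ℂ) • (Aᴴ * A)) * Aᴴ) ξ η * A η ζ :=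
        (intervalIntegral.integral_finsetSum fun η _ => hint η).symm
    _ = ∫ t in (0 : ℝ)..T, (NormedSpace.exp (t • (-(Aᴴ * A))) * (Aᴴ * A)) ξ ζ := by
        refine intervalIntegral.integral_congr fun t _ => ?_
        rw [← Matrix.mul_assoc, Matrix.mul_apply, sliceResummation_exp_smul]
    _ = ((1 : Matrix ι ι ℂ) - NormedSpace.exp (T • (-(Aᴴ * A)))) ξ ζ :=
        sliceResummation_ftc (Aᴴ * A) T ξ ζ
    _ = ((1 : Matrix ι ι ℂ) - NormedSpace.exp (-(T : ℂ) • (Aᴴ * A))) ξ ζ := by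
        rw [sliceResummation_exp_smul]

end Summit.QuantumFields.QCD.Cruxes.InterleavedHeatSliceFlow.Sketch

end
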